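import Summits.ValiantsHypothesis.ValiantsHypothesis.Theorems.LacunarySymmetroidMatrixDescartesWLawMonotone
import Summits.ValiantsHypothesis.ValiantsHypothesis.Theorems.LacunarySymmetroidMatrixDescartesStubDescartesCeiling

/-!
# `MatrixDescartes` (stmt-ValiantsHypothesis-18050) — the DESCARTES CEILING of the W-rows: `WLawAt n (C(n+3, 3) − 1)`
# for every `n`; the kernel bracket of the W-count is `10⌊n/3⌋ + (0,2,6)[n mod 3] ≤ w(n) ≤ C(n+3,3) − 1`

HONEST FRAMING.  Cell `pub-symmetroid`, seat `val-sym-mdr-p2` (gen 7); helper `--supports` the crux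
`Theses.LacunarySymmetroid.MatrixDescartes` (OPEN), NO closure claim.  The trivial UPPER row for the typed W-law family
`WLawAt n B` of `…WLawDefs`: a W-configuration `X^e J + X^{d₁} P₁ + X^{d₂} P₂ + X^{d₃} Q` is a four-letter lacunary pencil of
size `n`, so by the tree's count-vector Descartes ceiling `stub_descartesCeiling` (`Z₊ + 1 ≤ C(n + K − 1, n)`, `K = 4`) it has at
most `C(n+3, n) − 1 = C(n+3, 3) − 1` distinct positive determinant roots — no symmetry, no semidefiniteness and no ordering of the
exponents is used.  Together with the lower rows of `…WLawBlockSum` this is the current KERNEL BRACKET of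
`w(n) := min {B | WLawAt n B}`: `w(1) = 2`, `w(2) = 6` (`wLawAt_two_iff_six_le`), `10 ≤ w(3) ≤ 19`, `12 ≤ w(4) ≤ 34`, and in general
`10⌊n/3⌋ + (0,2,6)[n mod 3] ≤ w(n) ≤ (n+1)(n+2)(n+3)/6 − 1`.  Nothing here bears on the crux in its window, `DoorA26` / `DoorA34`,
the registers, or `VP ≠ VNP`.

[folklore] Elementary; tree inputs `stub_descartesCeiling`, `Fin.sum_univ_four`.  Axioms `propext`, `Classical.choice`, `Quot.sound`.
-/

-- `Summit.ValiantsHypothesis.ValiantsHypothesis.…` repeats a component by the single-conjunct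
-- summit layout, which the `dupNamespace` linter flags; the name is mandated.
set_option linter.dupNamespace false

namespace Summit.ValiantsHypothesis.ValiantsHypothesis.Theorems.LacunarySymmetroidMatrixDescartes

open scoped BigOperators Matrix
open Polynomial

/-- A W-pencil is the four-letter lacunary pencil with letters `![J, P₁, P₂, Q]` on the exponents `![e, d₁, d₂, d₃]`. [folklore] -/
theorem wPencil_eq_sum_four {n : ℕ} (e d₁ d₂ d₃ : ℕ) (J P₁ P₂ Q : Matrix (Fin n) (Fin n) ℝ) :
    ((X : ℝ[X]) ^ e) • J.map Polynomial.C + ((X : ℝ[X]) ^ d₁) • P₁.map Polynomial.C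
        + ((X : ℝ[X]) ^ d₂) • P₂.map Polynomial.C + ((X : ℝ[X]) ^ d₃) • Q.map Polynomial.C
      = ∑ l : Fin 4, ((X : ℝ[X]) ^ (![e, d₁, d₂, d₃] : Fin 4 → ℕ) l) •
          ((![J, P₁, P₂, Q] : Fin 4 → Matrix (Fin n) (Fin n) ℝ) l).map Polynomial.C := by
  rw [Fin.sum_univ_four]
  simp

/-- **Descartes ceiling of the W-rows**: `WLawAt n (C(n+3, n) − 1)` — every `n × n` W-configuration has at most
`C(n+3, 3) − 1` distinct positive determinant roots (count vectors of the four letters; tree `stub_descartesCeiling`). [folklore] -/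
theorem wLawAt_descartes (n : ℕ) : WLawAt n (Nat.choose (n + 3) n - 1) := by
  intro e d₁ d₂ d₃ J P₁ P₂ Q _ _ _ _ _ _ _
  have h := stub_descartesCeiling 4 n (by norm_num) (![e, d₁, d₂, d₃] : Fin 4 → ℕ)
    (![J, P₁, P₂, Q] : Fin 4 → Matrix (Fin n) (Fin n) ℝ)
  rw [← wPencil_eq_sum_four] at h
  have h43 : n + 4 - 1 = n + 3 := by omega
  rw [h43] at h
  omega

/-- `n = 3`: `WLawAt 3 19` (so `10 ≤ w(3) ≤ 19` in the kernel, with `not_wLawAt_three_nine`). [bookkeeping] -/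
theorem wLawAt_three_nineteen : WLawAt 3 19 := by
  have h := wLawAt_descartes 3
  norm_num [Nat.choose] at h
  exact h

/-- `n = 4`: `WLawAt 4 34` (so `12 ≤ w(4) ≤ 34` in the kernel, with `not_wLawAt_three_mul_sub_one` at `n = 4`). [bookkeeping] -/
theorem wLawAt_four_thirtyfour : WLawAt 4 34 := by
  have h := wLawAt_descartes 4
  norm_num [Nat.choose] at h
  exact h

/-- The kernel bracket at `n = 3` in one statement: `WLawAt 3 B ↔ 10 ≤ B` is open between `10` and `19`; precisely
`(WLawAt 3 B → 10 ≤ B) ∧ (19 ≤ B → WLawAt 3 B)`. [bookkeeping] -/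
theorem wLawAt_three_bracket (B : ℕ) : (WLawAt 3 B → 10 ≤ B) ∧ (19 ≤ B → WLawAt 3 B) :=
  ⟨ten_le_of_wLawAt_three, fun hB => wLawAt_mono wLawAt_three_nineteen hB⟩

end Summit.ValiantsHypothesis.ValiantsHypothesis.Theorems.LacunarySymmetroidMatrixDescartes
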